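import Mathlib

/-!
# Maximal minors of `[1 | Z]` are nonzero polynomials

For the generic `n × m'` matrix `Z = (X_{(i,j)})` over `ℂ` and an injective column tuple
`e : Fin n → Fin (n + m')` of the augmented matrix `[1 | Z] = (fromCols 1 Z) ∘ finSumFinEquiv.symm`,
the maximal minor `det ([1 | Z] ∘ e)` is a nonzero polynomial in `ℂ[Z]`.

Proof (the `GL_n` gauge): let `Y = [Y₁ | Y₂]` be the generic `n × (n ⊕ m')` matrix and `L` the
fraction field of `ℂ[Y]`.  The algebra map `ψ : ℂ[Z] → L`, `Z ↦ Y₁⁻¹ Y₂`, sends `[1 | Z]` to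
`Y₁⁻¹ [Y₁ | Y₂]`, so it sends the minor on `e` to `det Y₁⁻¹ · det ([Y₁ | Y₂] ∘ e)`, a unit times the
image of a renamed generic determinant `det (Matrix.mvPolynomialX)`, which is nonzero. [folklore]
-/

set_option linter.dupNamespace false

namespace Summit.MatrixMultiplication.MatrixMultiplication.Theorems.CondensationSound

/-- For an injective ring hom `φ` out of `MvPolynomial (m × τ) R` and an injective `g : m → τ`,
the matrix `(φ (X (i, g a)))_{i a}` has nonzero determinant: it is the image of the generic square
matrix `Matrix.mvPolynomialX m m R` under `rename (Prod.map id g)` followed by `φ`. [folklore] -/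
theorem det_of_ringHom_X_comp_ne_zero {m τ R L : Type*} [Fintype m] [DecidableEq m]
    [CommRing R] [Nontrivial R] [CommRing L]
    (φ : MvPolynomial (m × τ) R →+* L) (hφ : Function.Injective φ)
    (g : m → τ) (hg : Function.Injective g) :
    (Matrix.of fun i a => φ (MvPolynomial.X (i, g a))).det ≠ 0 := by
  have hρ : Function.Injective (Prod.map id g : m × m → m × τ) :=
    Function.injective_id.prodMap hg
  have hM : (Matrix.of fun i a => φ (MvPolynomial.X (i, g a))) =
      φ.mapMatrix ((MvPolynomial.rename (Prod.map id g : m × m → m × τ)).toRingHom.mapMatrix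
        (Matrix.mvPolynomialX m m R)) := by
    ext i a
    simp [Matrix.mvPolynomialX_apply, MvPolynomial.rename_X]
  rw [hM, ← RingHom.map_det, ← RingHom.map_det]
  intro h
  have h1 : (MvPolynomial.rename (Prod.map id g : m × m → m × τ)).toRingHom
      (Matrix.mvPolynomialX m m R).det = 0 :=
    hφ (by rw [h, map_zero])
  have h2 : (Matrix.mvPolynomialX m m R).det = 0 :=
    MvPolynomial.rename_injective _ hρ (by rw [map_zero]; exact h1)
  exact Matrix.det_mvPolynomialX_ne_zero m R h2

/-- Maximal minors of `[1 | Z]` are nonzero polynomials: for the generic `n × m'` matrix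
`Z = (X_{(i,j)})` and an injective column tuple `e : Fin n → Fin (n + m')` of
`[1 | Z] = (fromCols 1 Z) ∘ finSumFinEquiv.symm`, `det ([1 | Z] ∘ e) ≠ 0` in `ℂ[Z]`
(the `GL_n` gauge `Z ↦ Y₁⁻¹ Y₂`). [folklore] -/
theorem stub_nonvanishing :
    ∀ (n m' : ℕ) (e : Fin n → Fin (n + m')), Function.Injective e →
      (((Matrix.fromCols (1 : Matrix (Fin n) (Fin n) (MvPolynomial (Fin n × Fin m') ℂ))
          (Matrix.of fun i j => MvPolynomial.X (i, j))).submatrix id ⇑finSumFinEquiv.symm).submatrix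
            id e).det ≠ 0 := by
  intro n m' e he
  -- the generic `n × (n ⊕ m')` matrix `Y = [Y₁ | Y₂]` over the fraction field `L` of `ℂ[Y]`
  let L := FractionRing (MvPolynomial (Fin n × (Fin n ⊕ Fin m')) ℂ)
  let φ : MvPolynomial (Fin n × (Fin n ⊕ Fin m')) ℂ →+* L := algebraMap _ L
  have hφ : Function.Injective φ := IsFractionRing.injective _ _
  let Y₁ : Matrix (Fin n) (Fin n) L := Matrix.of fun i j => φ (MvPolynomial.X (i, Sum.inl j))
  let Y₂ : Matrix (Fin n) (Fin m') L := Matrix.of fun i j => φ (MvPolynomial.X (i, Sum.inr j))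
  have hY : Matrix.fromCols Y₁ Y₂ = Matrix.of fun i s => φ (MvPolynomial.X (i, s)) := by
    ext i (j | j) <;> rfl
  have hY₁ : Y₁.det ≠ 0 := det_of_ringHom_X_comp_ne_zero φ hφ Sum.inl Sum.inl_injective
  have hY₁u : IsUnit Y₁.det := isUnit_iff_ne_zero.mpr hY₁
  -- the gauge map `Z ↦ Y₁⁻¹ Y₂`
  let ψ : MvPolynomial (Fin n × Fin m') ℂ →ₐ[ℂ] L :=
    MvPolynomial.aeval fun p => (Y₁⁻¹ * Y₂) p.1 p.2
  have hψA : (Matrix.fromCols (1 : Matrix (Fin n) (Fin n) (MvPolynomial (Fin n × Fin m') ℂ))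
      (Matrix.of fun i j => MvPolynomial.X (i, j))).map ψ = Y₁⁻¹ * Matrix.fromCols Y₁ Y₂ := by
    rw [Matrix.mul_fromCols, Matrix.nonsing_inv_mul _ hY₁u, Matrix.fromCols_map]
    congr 1
    · exact Matrix.map_one _ (map_zero _) (map_one _)
    · ext i j
      simp [ψ, MvPolynomial.aeval_X]
  intro h
  have h' := congr_arg ψ h
  rw [map_zero, AlgHom.map_det, AlgHom.mapMatrix_apply, ← Matrix.submatrix_map,
    ← Matrix.submatrix_map, hψA, Matrix.submatrix_submatrix, Function.id_comp,
    Matrix.submatrix_mul _ _ _ id _ Function.bijective_id, Matrix.submatrix_id_id,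
    Matrix.det_mul, mul_eq_zero] at h'
  rcases h' with h' | h'
  · exact (Matrix.isUnit_nonsing_inv_det Y₁ hY₁u).ne_zero h'
  · have hsub : (Matrix.fromCols Y₁ Y₂).submatrix id (⇑finSumFinEquiv.symm ∘ e) =
        Matrix.of fun i a => φ (MvPolynomial.X (i, (⇑finSumFinEquiv.symm ∘ e) a)) := by
      rw [hY]
      ext i a
      rfl
    rw [hsub] at h'
    exact det_of_ringHom_X_comp_ne_zero φ hφ _ (finSumFinEquiv.symm.injective.comp he) h'

end Summit.MatrixMultiplication.MatrixMultiplication.Theorems.CondensationSound
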